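import Summits.Ventures.LatticeQCDFlow.Scoring.SU2PlaquetteSeriesFubini
import Summits.Ventures.LatticeQCDFlow.Scoring.SU2HaarClassAngle
import Summits.Ventures.LatticeQCDFlow.Scaling.LatticeActionLevelSets
import Literature.MathematicalPhysics.QuantumFieldTheory.LatticeGaugeProofs
import HarnessLib

/-!
# SU(2): the Wilson partition function on `(ℤ/L)^d` as an absolutely convergent CHARACTER EXPANSION `Z = Σ_{x : plaquettes → ℕ} (∏_p c_{x_p}(β)) · ∫ ∏_p U_{x_p}(a₀(U_∂p)) dHaar^E`

HONEST FRAMING: exact (Metropolis-corrected) sampling algorithms for lattice gauge theory;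
figures of merit are autocorrelation/cost numbers at stated couplings and volumes; no
continuum-physics claim.

Venture `LatticeQCDFlow` (cell pub-lqcd), sub-topic `Scoring`; FANOUT row 5 (`s0-sun-a`), GEN-9.
NEW WORK of the cell (placement rule).  Step 6a of row 5's route to the exact SU(2) torus formula,
ON THE LATTICE: theory-2's partition function `partitionFunction (fundamentalRep (Fin 2)) β` of
`Literature/…/ConstructiveQFTWave0` in every dimension `d` and volume `L` equals the absolutely
convergent multi-series of Haar integrals of products of characters `U_n(a₀(U_∂p))`
(**`partitionFunction_su2_toReal_eq_tsum`**), by `SU2PlaquetteSeriesFubini.integral_prod_plaqWeight_eq_tsum`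
re-indexed to an arbitrary finite index type (`integral_prod_plaqWeight_eq_tsum_fintype`).

What remains for `Z_{(ℤ/L)²}^{SU(2)}(β) = Σ_n (c_n(β)/(n+1))^{L²}` is the evaluation of the Haar
integrals `∫ ∏_p U_{x_p}(a₀(U_∂p)) dHaar^E = [x constant = n]·(n+1)^{−L²}` for `d = 2` (face merging
`integral_su2Character_mul_conv` + handle identity `integral_su2Character_handle`) — NOT TYPED here.
No new definition; nothing cited.
-/

noncomputable section

open Real MeasureTheory Set Filter Topology Finset Polynomial.Chebyshev
open Literature.MathematicalPhysics.QuantumFieldTheory Literature.MathematicalPhysics.QuantumLattice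
open Literature.Analysis.FunctionSpaces
open Summit.Ventures.LatticeQCDFlow.Exactness
open Summit.Ventures.LatticeQCDFlow.Theory2.Lattice

namespace Summit.Ventures.LatticeQCDFlow.Scoring

/-! ## §1. Re-indexing the abstract Fubini to a finite index type -/

/-- `SU2PlaquetteSeriesFubini.integral_prod_plaqWeight_eq_tsum` for an arbitrary finite index type
of plaquettes. -/
theorem integral_prod_plaqWeight_eq_tsum_fintype {Ω : Type*} [MeasurableSpace Ω] (μ : Measure Ω)
    [IsProbabilityMeasure μ] {β : ℝ} (hβ : 0 ≤ β) {ι : Type*} [Fintype ι] (a : ι → Ω → ℝ)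
    (ham : ∀ p, Measurable (a p)) (ha : ∀ p ω, a p ω ∈ Icc (-1 : ℝ) 1) :
    (Summable fun x : ι → ℕ => (∏ p, Real.exp (-(2 * β)) *
        (besselI (x p) (2 * β) - besselI (x p + 2) (2 * β))) *
        ∫ ω, ∏ p, (U ℝ (x p)).eval (a p ω) ∂μ) ∧
    ∫ ω, ∏ p, Real.exp (-(β * (2 - 2 * a p ω))) ∂μ =
      ∑' x : ι → ℕ, (∏ p, Real.exp (-(2 * β)) *
        (besselI (x p) (2 * β) - besselI (x p + 2) (2 * β))) *
        ∫ ω, ∏ p, (U ℝ (x p)).eval (a p ω) ∂μ := by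
  classical
  set e : ι ≃ Fin (Fintype.card ι) := Fintype.equivFin ι with he
  -- the Fin-indexed instance
  have hfin := integral_prod_plaqWeight_eq_tsum μ hβ (fun j => a (e.symm j)) (fun j => ham _)
    (fun j ω => ha _ ω)
  -- transport along Φ : (ι → ℕ) ≃ (Fin F → ℕ), Φ x j = x (e.symm j)
  set Φ : (ι → ℕ) ≃ (Fin (Fintype.card ι) → ℕ) := Equiv.piCongrLeft' (fun _ : ι => ℕ) e with hΦ
  set T : (Fin (Fintype.card ι) → ℕ) → ℝ := fun y => (∏ j, Real.exp (-(2 * β)) *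
      (besselI (y j) (2 * β) - besselI (y j + 2) (2 * β))) *
      ∫ ω, ∏ j, (U ℝ (y j)).eval (a (e.symm j) ω) ∂μ with hT
  have hTΦ : ∀ x : ι → ℕ, T (Φ x) = (∏ p, Real.exp (-(2 * β)) *
      (besselI (x p) (2 * β) - besselI (x p + 2) (2 * β))) *
      ∫ ω, ∏ p, (U ℝ (x p)).eval (a p ω) ∂μ := by
    intro x
    have h1 : (∏ j, Real.exp (-(2 * β)) * (besselI (Φ x j) (2 * β) - besselI (Φ x j + 2) (2 * β))) =
        ∏ p, Real.exp (-(2 * β)) * (besselI (x p) (2 * β) - besselI (x p + 2) (2 * β)) :=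
      e.symm.prod_comp (fun p => Real.exp (-(2 * β)) * (besselI (x p) (2 * β) - besselI (x p + 2) (2 * β)))
    have h2 : ∀ ω, (∏ j, (U ℝ (Φ x j)).eval (a (e.symm j) ω)) = ∏ p, (U ℝ (x p)).eval (a p ω) :=
      fun ω => e.symm.prod_comp (fun p => (U ℝ (x p)).eval (a p ω))
    rw [hT]
    simp only
    rw [h1]
    simp_rw [h2]
  have hprodw : ∀ ω, (∏ j, Real.exp (-(β * (2 - 2 * a (e.symm j) ω)))) =
      ∏ p, Real.exp (-(β * (2 - 2 * a p ω))) :=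
    fun ω => e.symm.prod_comp (fun p => Real.exp (-(β * (2 - 2 * a p ω))))
  simp_rw [hprodw] at hfin
  obtain ⟨hs, hi⟩ := hfin
  refine ⟨?_, ?_⟩
  · have : Summable (T ∘ Φ) := (Φ.summable_iff (f := T)).mpr hs
    refine this.congr fun x => ?_
    rw [Function.comp_apply, hTΦ]
  · rw [hi, ← Φ.tsum_eq]
    exact tsum_congr fun x => hTΦ x

/-! ## §2. The lattice partition function as a character expansion -/

/-- The SU(2) Wilson weight of a configuration as the product of plaquette weights
`e^{−β S(U)} = ∏_p e^{−β(2 − 2a₀(U_∂p))}`. -/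
theorem exp_neg_mul_wilsonAction_su2 {d L : ℕ} [NeZero L] (β : ℝ)
    (V : GaugeConfig d L (Matrix.specialUnitaryGroup (Fin 2) ℂ)) :
    Real.exp (-β * wilsonAction (fundamentalRep (Fin 2)) V) =
      ∏ p : Plaquette d L, Real.exp (-(β * (2 - 2 * su2a0 (plaquetteHolonomy V p.1 p.2.1.1 p.2.1.2)))) := by
  rw [wilsonAction, Finset.mul_sum, Real.exp_sum]
  refine Finset.prod_congr rfl fun p _ => ?_
  rw [fundamentalRep_trace_re]
  norm_num

/-- **THE CHARACTER EXPANSION OF THE SU(2) WILSON PARTITION FUNCTION** (every `d`, `L`; `β ≥ 0`):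
`Z_{(ℤ/L)^d}^{SU(2)}(β) = Σ'_{x : plaquettes → ℕ} (∏_p c_{x_p}(β)) · ∫ ∏_p U_{x_p}(a₀(U_∂p)) dHaar^E`
with `c_n(β) = e^{−2β}(I_n(2β) − I_{n+2}(2β))`, the series converging absolutely. -/
theorem partitionFunction_su2_toReal_eq_tsum (d L : ℕ) [NeZero L] {β : ℝ} (hβ : 0 ≤ β) :
    (Summable fun x : Plaquette d L → ℕ => (∏ p, Real.exp (-(2 * β)) *
        (besselI (x p) (2 * β) - besselI (x p + 2) (2 * β))) *
        ∫ V, ∏ p : Plaquette d L, (U ℝ (x p)).eval (su2a0 (plaquetteHolonomy V p.1 p.2.1.1 p.2.1.2))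
          ∂(Measure.pi fun _ : Edge d L => haarProbability (Matrix.specialUnitaryGroup (Fin 2) ℂ))) ∧
    (partitionFunction (d := d) (L := L) (fundamentalRep (Fin 2)) β).toReal =
      ∑' x : Plaquette d L → ℕ, (∏ p, Real.exp (-(2 * β)) *
        (besselI (x p) (2 * β) - besselI (x p + 2) (2 * β))) *
        ∫ V, ∏ p : Plaquette d L, (U ℝ (x p)).eval (su2a0 (plaquetteHolonomy V p.1 p.2.1.1 p.2.1.2))
          ∂(Measure.pi fun _ : Edge d L => haarProbability (Matrix.specialUnitaryGroup (Fin 2) ℂ)) := by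
  haveI : SecondCountableTopology (Matrix (Fin 2) (Fin 2) ℂ) :=
    inferInstanceAs (SecondCountableTopology (Fin 2 → Fin 2 → ℂ))
  haveI : SecondCountableTopology (Matrix.specialUnitaryGroup (Fin 2) ℂ) :=
    TopologicalSpace.Subtype.secondCountableTopology _
  set μ : Measure (GaugeConfig d L (Matrix.specialUnitaryGroup (Fin 2) ℂ)) :=
    Measure.pi fun _ : Edge d L => haarProbability (Matrix.specialUnitaryGroup (Fin 2) ℂ) with hμ
  have ham : ∀ p : Plaquette d L, Measurable fun V : GaugeConfig d L (Matrix.specialUnitaryGroup (Fin 2) ℂ) =>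
      su2a0 (plaquetteHolonomy V p.1 p.2.1.1 p.2.1.2) :=
    fun p => continuous_su2a0.measurable.comp
      (Literature.MathematicalPhysics.QuantumFieldTheory.measurable_plaquetteHolonomy p.1 p.2.1.1 p.2.1.2)
  have ha : ∀ (p : Plaquette d L) (V : GaugeConfig d L (Matrix.specialUnitaryGroup (Fin 2) ℂ)),
      su2a0 (plaquetteHolonomy V p.1 p.2.1.1 p.2.1.2) ∈ Icc (-1 : ℝ) 1 :=
    fun p V => abs_le.mp (abs_su2a0_le_one _)
  have h := integral_prod_plaqWeight_eq_tsum_fintype μ hβ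
    (fun (p : Plaquette d L) (V : GaugeConfig d L (Matrix.specialUnitaryGroup (Fin 2) ℂ)) =>
      su2a0 (plaquetteHolonomy V p.1 p.2.1.1 p.2.1.2)) ham ha
  refine ⟨h.1, ?_⟩
  rw [← h.2]
  -- Z.toReal = ∫ e^{−βS}; measurability through the plaquette traces (no Borel structure on G^E needed)
  have hmeas : Measurable fun V : GaugeConfig d L (Matrix.specialUnitaryGroup (Fin 2) ℂ) =>
      Real.exp (-β * wilsonAction (fundamentalRep (Fin 2)) V) := by
    have e : (fun V : GaugeConfig d L (Matrix.specialUnitaryGroup (Fin 2) ℂ) =>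
        Real.exp (-β * wilsonAction (fundamentalRep (Fin 2)) V)) = fun V =>
        ∏ p : Plaquette d L, Real.exp (-(β * (2 - 2 * su2a0 (plaquetteHolonomy V p.1 p.2.1.1 p.2.1.2)))) :=
      funext fun V => exp_neg_mul_wilsonAction_su2 β V
    rw [e]
    refine Finset.measurable_prod _ fun p _ => ?_
    exact Real.measurable_exp.comp ((measurable_const.mul (ham p)).const_sub _ |>.const_mul _ |>.neg)
  have hnn : ∀ V : GaugeConfig d L (Matrix.specialUnitaryGroup (Fin 2) ℂ),
      0 ≤ Real.exp (-β * wilsonAction (fundamentalRep (Fin 2)) V) := fun V => Real.exp_nonneg _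
  have hle : ∀ V : GaugeConfig d L (Matrix.specialUnitaryGroup (Fin 2) ℂ),
      Real.exp (-β * wilsonAction (fundamentalRep (Fin 2)) V) ≤ 1 := by
    intro V
    rw [Real.exp_le_one_iff, neg_mul, neg_nonpos]
    refine mul_nonneg hβ (Finset.sum_nonneg fun p _ => ?_)
    rw [fundamentalRep_trace_re]
    have := abs_le.mp (abs_su2a0_le_one (plaquetteHolonomy V p.1 p.2.1.1 p.2.1.2))
    push_cast; linarith [this.2]
  have hint : Integrable (fun V => Real.exp (-β * wilsonAction (fundamentalRep (Fin 2)) V)) μ :=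
    Integrable.mono' (integrable_const (1 : ℝ)) hmeas.aestronglyMeasurable
      (Eventually.of_forall fun V => by rw [Real.norm_eq_abs, abs_of_nonneg (hnn V)]; exact hle V)
  rw [partitionFunction_eq_lintegral, ← hμ,
    ← ofReal_integral_eq_lintegral_ofReal hint (Eventually.of_forall hnn),
    ENNReal.toReal_ofReal (integral_nonneg hnn)]
  exact integral_congr_ae (Eventually.of_forall fun V => exp_neg_mul_wilsonAction_su2 β V)

end Summit.Ventures.LatticeQCDFlow.Scoring
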